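import Summits.BirchSwinnertonDyer.Rank1Residual.ManinAdditive.TwoEisensteinRankOneLaws
import HarnessLib
import HarnessLib.Audit.Tags

/-!
# The SUPERSINGULAR LEGENDRE MODULE behind 2-Eisenstein rank one at level `4p` — rank vocabulary, E-imc-94
# `FourPTwoPRankLaw`, E-imc-95 `FourPTwoEisensteinCongruence`, E-imc-96, Mazur at level `p`, E-94♭ PROVED — BY NAME
# (cell `bsd-f2-manin`, planner-of-record `bsd-f2-manin-imc` g16, MEMO-imc §22 / PROOFS-g16; typing ask T-imc-10; REF1 §R65 GO)

HONEST FRAMING.  LENS = Eisenstein ideal / mod-2 congruences (planner `bsd-f2-manin-imc`, g16; HOME/imc/MEMO-imc.md §22,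
HOME/imc/PROOFS-g16.md; source HOME/imc/Sketch-imc-g16.lean 9f07f1c8a261b8cb, 176 l., farm rc 0).  A sibling of
`TwoEisensteinRankOneLaws.lean` (imc g15 rows E-imc-81…90, 304 l.; kept apart to hold that file under 400 lines; SAME namespace
`…ManinAdditive.TwoEisenstein`), landed by the cell typer (gen 12) on refuter-1's verdicts (§R65, HOME/ref1/R65-ref1-imc-g16.md
360c58723054a380, 2026-08-28T13:16Z: typed rows 5 Props + 1 edge + 4 vocabulary defs ALL SURVIVE / 0 KILLED, BC7 6 / 6 CLEAN;
**E-imc-94 / 95 / 96 and `MazurNoTwoEisensteinPrimeLevel` are THEOREMS ON PAPER** modulo the Deligne–Rapoport / Ribet dictionary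
(PROOFS-g16 §1–§2, §9), filed here as `@[conjecture]` obligation nodes until formalized; ENGINE E1 9590 / 9590, E2 107 / 107).
Per §R65 H-1 the sketch's re-declared `IsTwiceIntegral` / `IsTwoEisensteinNilpotent` are NOT re-declared: this file IMPORTS the tree
vocabulary of `TwoEisensteinRankOneLaws.lean` (identical bodies); H-2 (E-96 docstring), H-3 (Mazur citation), H-6 (`5 ≤ p` in
E-94's `p ≡ 3 (8)` sentence) are repaired in the docstrings; everything else VERBATIM.

THE MECHANISM (imc g16).  `J₀(4p)` has purely toric reduction at `p`; its character group is `X = ℤ[Σ]⁰`, `Σ = Σ₄(p)` the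
`(p−1)/2` supersingular LEGENDRE parameters, with `T_ℓ` the Legendre–Brandt matrix and `X ⊗ ℚ ≅ S₂(Γ₀(4p))` (levels `p, 2p, 4p`
with multiplicities `3, 2, 1`).  (1) PARITY (E-imc-95): `e = Σ_λ [λ]` has `T_ℓ e = (ℓ+1) e` and `ē ∈ X/2X` iff `p ≡ 1 (mod 4)`
⟹ a 2-Eisenstein congruence of depth `v₂((p−1)/2)` at level `4p`.  (2) ISOTYPIC COINCIDENCE MOD 2 (E-imc-94): the sgn-isotypic
lattice and Mazur's `ℤ[SS_j]` have the same reduction mod 2 ⟹ `e_{4p}^{new} = e_p + [p ≡ 1 (mod 4)]`, typed newform-free as the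
rank identity `D(4p) + D(p) = 2·D(2p) + [p ≡ 1 (4)]`.  (3) REDUCTION: tree E-imc-85 `FourPTwoEisensteinRankOne` ⟸ E-imc-94 ∧ Mazur
∧ tree E-imc-81 `TwoPNoTwoEisenstein` — so the ONLY open input of the blind-tame-family route «… ⟹ r_f odd ⟹ deg φ odd ⟹ 2 ∤ c»
(stub 6d of `kato_shift_two`) is E-81 = the generalized Ogg conjecture at `N = 2p`, 2-part (imc E-115; Yoo 2019 Conj. 1.2).
Bridges still to type (XS, REF1 RA73.9 / RA73.13): `TwoPNoTwoEisenstein ↔ ∀ p ≡ ±3 (8), TwoEisensteinRankEq (2p) 0` and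
`TwoEisensteinRankEq (4p) 1 → FourPTwoEisensteinRankOne`-instance.

CENSUS (BC5; engine 2 = pure `𝔽_{p²}` arithmetic; HOME/imc/g16-ss4-census-le373.txt ba163f94211b2999): 68 odd primes
`7 ≤ p ≤ 373`; split `(e_p, e_{2p}^{new}, e_{4p}^{new})`: `p ≡ 5 (8)`: `(0,0,1)` 22/22; `p ≡ 3 (8)`: `(0,0,0)`; `p ≡ 7 (8)`:
`(0, 2^{v₂h(−8p)−1} − 1, 0)` 14/14; `p ≡ 1 (8)`: `e_{4p}^{new} = e_p + 1` 15/15; old-form identity 52/52; later kit harvest (§22.13):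
E-94's prediction on a second module 71/71 + 55/55.  Refuter-2 placement R-imc-37/38/41/42 pending (§R65 presearch: no print source
for the 4p/2p laws).  PARTITION 0 · beyond-print theorem: no · bears_on stmt-BirchSwinnertonDyer-22967 (C2, stub 6d) · BSD is not
proved by this; Manin's conjecture is not proved by this.
-/

set_option autoImplicit false

noncomputable section

open scoped MatrixGroups
open CongruenceSubgroup
open Literature.NumberTheory.EllipticCurves Literature.NumberTheory.EllipticCurves.ModularForms

namespace Summit.BirchSwinnertonDyer.Rank1Residual.ManinAdditive.TwoEisenstein

/-- `g ∈ k · S₂(Γ₀(N); ℤ)` for a natural number `k`. [folklore] -/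
def IsMultipleIntegral (N k : ℕ) (g : CuspForm (Gamma0 N) 2) : Prop :=
  ∃ h ∈ integralCuspForms0 N 2, g = (k : ℂ) • h

/-- **2-Eisenstein rank ≤ r**: `r` integral forms span the 2-Eisenstein-nilpotent forms modulo `2·S₂(ℤ)`. [folklore] -/
def TwoEisensteinRankLE (N : ℕ) [NeZero N] (r : ℕ) : Prop :=
  ∃ gs : Fin r → CuspForm (Gamma0 N) 2, (∀ i, gs i ∈ integralCuspForms0 N 2) ∧
    ∀ g : CuspForm (Gamma0 N) 2, IsTwoEisensteinNilpotent N g →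
      ∃ c : Fin r → ℤ, IsTwiceIntegral N (g - ∑ i, ((c i : ℤ) : ℂ) • gs i)

/-- **2-Eisenstein rank ≥ r**: `r` 2-Eisenstein-nilpotent integral forms linearly independent modulo `2·S₂(ℤ)`. [folklore] -/
def TwoEisensteinRankGE (N : ℕ) [NeZero N] (r : ℕ) : Prop :=
  ∃ gs : Fin r → CuspForm (Gamma0 N) 2, (∀ i, IsTwoEisensteinNilpotent N (gs i)) ∧
    ∀ c : Fin r → ℤ, IsTwiceIntegral N (∑ i, ((c i : ℤ) : ℂ) • gs i) → ∀ i, (2 : ℤ) ∣ c i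

/-- **2-Eisenstein rank = r** (`= rank_{ℤ₂} 𝕋(Γ₀(N))_𝔪` at the anemic 2-Eisenstein maximal ideal, `0` if none; in the supersingular
dictionary for `N ∈ {p, 2p, 4p}`: `D(N)` = the `𝔽₂`-dimension of the even-weight 2-Eisenstein generalized eigenspace of the
corresponding supersingular module). [folklore] -/
def TwoEisensteinRankEq (N : ℕ) [NeZero N] (r : ℕ) : Prop :=
  TwoEisensteinRankLE N r ∧ TwoEisensteinRankGE N r

/-! ### §2. The parity lemma, typed (THEOREM-candidates; existence side) -/

/-- **LEMMA-imc-g16-1 / candidate E-imc-95 `FourPTwoEisensteinCongruence` (THEOREM-candidate, elementary modulo the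
Deligne–Rapoport/Ribet dictionary `X(J₀(4p), p) = ℤ[Σ₄(p)]⁰` + the `ℤ`-duality `S₂(Γ₀(N); ℤ) ≅ Hom(𝕋, ℤ)`).**  For a prime `p ≡ 1 (mod 4)`
there is an integral cusp form `g` of level `4p`, `g ∉ 2·S₂(ℤ)`, with `T_ℓ g ≡ (1 + ℓ) g (mod 2^{v₂(p−1)−1} · S₂(ℤ))` for every odd prime
`ℓ ≠ p` — an Eisenstein congruence of 2-adic depth `v₂((p−1)/2)` (`= 1` iff `p ≡ 5 (mod 8)`; one deeper than Mazur's `v₂(num((p−1)/12))`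
at level `p` when `p ≡ 1 (mod 8)`).  Proof sketch: `x₀ = Σ_λ[λ] − ((p−1)/2)[λ₀] ∈ X ∖ 2X` has `(T_ℓ − ℓ − 1)x₀ ∈ ((p−1)/2)·X`, so
`𝕋/I_Eis ↠ ℤ/((p−1)/2)`; dualise.  In particular `TwoEisensteinRankGE (4p) 1` for all `p ≡ 1 (mod 4)` (census: 33/33, `p ≤ 373`).
Why it might fail: only through the dictionary (weights / the identification of `T_ℓ`), not in substance. [THEOREM-candidate — NOT
kernel-proved here] 
REF1 §R65 (R-imc-35, HOME/ref1/R65-ref1-imc-g16.md 360c58723054a380): SURVIVES = THEOREM ON PAPER (mod the Deligne–Rapoport /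
Ribet dictionary D2 + ℤ-duality; PROOFS-g16 §1 checked line by line, weights all 1, k ≥ 2); filed as an open tree obligation until
formalized; typed VERBATIM from Sketch-imc-g16 9f07f1c8a261b8cb (typer g12, T-imc-10).
[cite: Ribet1990, §3 (character group of J₀(Np) at p = ℤ[supersingular points]⁰; shape — the 4p congruence is the cell's E-imc-95, NOT in print per §R65 presearch)] -/
@[conjecture]
def FourPTwoEisensteinCongruence : Prop :=
  ∀ (p : ℕ) [NeZero (4 * p)], p.Prime → p % 4 = 1 →
    ∃ g : CuspForm (Gamma0 (4 * p)) 2, g ∈ integralCuspForms0 (4 * p) 2 ∧ ¬ IsTwiceIntegral (4 * p) g ∧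
      ∀ (ℓ : ℕ) (hℓ : ℓ.Prime), Odd ℓ → ℓ ≠ p →
        IsMultipleIntegral (4 * p) (2 ^ (padicValNat 2 (p - 1) - 1))
          ((haveI : NeZero ℓ := ⟨hℓ.ne_zero⟩; heckeT (Gamma0 (4 * p)) 2 ℓ) g - ((1 + ℓ : ℕ) : ℂ) • g)

/-- **Candidate E-imc-96 `TwoPTwoEisensteinExistsSevenModEight` (THEOREM ON PAPER — REF1 §R65: via PROOFS-g16 §9 Prop. 9.1
(even cuspidal order at `p ≡ ±1 (8)`) + Prop. 9.2 (⟹) + Mazur's Thm. 1; the sketch's «same parity count on `SS(X₀(2)) =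
Σ₄(p)/⟨λ↦1/λ⟩`» heuristic FAILS as written — the weight-2 point `(E₁₇₂₈, ker(1+i))` on `X₀(2)` gives `T̄₃·𝟙 ≠ 0` in `𝔽₂[Σ/τ]` at
`p = 23, 31, 47, 71, 79` (§R65 H-2 / ENGINE E3) — docstring repaired here by the typer).**  For a prime `p ≡ 7 (mod 8)` there is a 2-Eisenstein form at level `2p` (it is
`2p`-new since Mazur excludes level `p`); census: 18/18 levels `2p`, `p ≡ 7 (8)`, `p ≤ 367`, with `e_{2p}^{new} = 2^{v₂h(−8p)−1} − 1`
(E-imc-93, 14/14 split rows).  [THEOREM-candidate — NOT kernel-proved here] 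
[cite: Mazur1977, Thm. 1 and Prop. II.9.7 (Eisenstein ideal at prime level; the level-2p existence statement is the cell's E-imc-96, THEOREM on paper per §R65, NOT in print)] -/
@[conjecture]
def TwoPTwoEisensteinExistsSevenModEight : Prop :=
  ∀ (p : ℕ) [NeZero (2 * p)], p.Prime → p % 8 = 7 →
    ∃ g : CuspForm (Gamma0 (2 * p)) 2, IsTwoEisensteinNilpotent (2 * p) g ∧ ¬ IsTwiceIntegral (2 * p) g

/-! ### §3. The isotypic coincidence mod 2, typed as a rank law (THEOREM-candidate E-imc-94) -/

/-- **Candidate E-imc-94 `FourPTwoPRankLaw` (THEOREM-candidate; the g16 lever).**  For every prime `p ≥ 5` the 2-Eisenstein ranks at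
levels `p`, `2p`, `4p` satisfy `D(4p) + D(p) = 2·D(2p) + [p ≡ 1 (mod 4)]`.  Reason: `D(4p) = 3e_p + 2e_{2p}^{new} + e_{4p}^{new}`,
`D(2p) = 2e_p + e_{2p}^{new}`, `D(p) = e_p` (old-form multiplicities), and `e_{4p}^{new} − e_p = [p ≡ 1 (mod 4)]` because the
sgn-isotypic lattice of `ℤ[Σ₄(p)]` and Mazur's module `ℤ[SS_j]` have the SAME reduction mod 2 (the Brandt module on `SS_j ∖ {1728}`),
of which the `S₃`-invariant lattice is the even hyperplane exactly when `p ≡ 1 (mod 4)`.  Census (engine 2, three quotient modules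
computed independently): 52/52 primes `p ≤ 373`.  COROLLARY with Mazur (`D(p) = 0` for `p ≢ 1 (8)`): `p ≡ 5 (8) ⇒ D(4p) = 2D(2p) + 1`,
so `FourPTwoEisensteinRankOne ⟸ TwoPNoTwoEisenstein` (E-85 ⟸ E-81); `p ≡ 3 (8)` (with `5 ≤ p`, §R65 H-6) `⇒ D(4p) = 2D(2p)`
(so E-86 ⟸ E-81 as well);
`p ≡ 1 (8)`: `e_{4p}^{new} = e_p + 1 = 2^{v₂h(−4p)−1}` whenever CE05's formula holds at level `p` (E-88′ ⟸ CE).  Why it might fail: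
only if the dictionary mis-identifies the sgn-part with the `4p`-new part (dimension check `d_{4p}^{new} = #SS_j − [1728 ∈ SS_j]` passes
at every `p ≤ 373`). [THEOREM-candidate — NOT kernel-proved here] 
REF1 §R65: SURVIVES = THEOREM ON PAPER mod dictionary D1–D3 (PROOFS-g16 §1–§2 VALID line by line incl. the parity lemma at
`j = 1728`; typed faithfully — odd-anemic `D(N)`, old multiplicities; not vacuous RA73.7–9; ENGINE E1 9590 / 9590
`new(4p) = g(p) + [p ≡ 1 (4)]`); filed as an open tree obligation until formalized; VERBATIM Sketch-imc-g16 (T-imc-10).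
[cite: Ribet1990, §3 (character group dictionary; the 4p/2p/p rank law is the cell's E-imc-94, NOT in print per §R65 presearch)] [cite: CalegariEmerton2005, Thm. 1.1 (the level-p 2-Eisenstein rank, p ≡ 9 (16))] -/
@[conjecture]
def FourPTwoPRankLaw : Prop :=
  ∀ (p : ℕ) [NeZero p] [NeZero (2 * p)] [NeZero (4 * p)], p.Prime → 5 ≤ p →
    ∀ r₁ r₂ r₄ : ℕ, TwoEisensteinRankEq p r₁ → TwoEisensteinRankEq (2 * p) r₂ → TwoEisensteinRankEq (4 * p) r₄ →
      r₄ + r₁ = 2 * r₂ + (if p % 4 = 1 then 1 else 0)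

/-- **E-imc-94♭ (the `p ≡ 5 (mod 8)` instance used by the family route):** `D(4p) = 2·D(2p) + 1`.  With `TwoPNoTwoEisenstein`
(E-imc-81: `D(2p) = 0` for `p ≡ ±3 (8)`) this is `D(4p) = 1` = `FourPTwoEisensteinRankOne` (E-imc-85). 
Plain `def` (NOT a new law): PROVED from E-imc-94 ∧ Mazur ∧ existence of the rank by `fourPRankFromTwoP_of_rankLaw` below
(REF1 §R65 RA73.13: with tree E-81 `TwoPNoTwoEisenstein` = `TwoEisensteinRankEq (2p) 0` and a 3-line bridge
`TwoEisensteinRankEq (4p) 1 →` tree E-85 `FourPTwoEisensteinRankOne`, the chain E-94♭ + E-81 ⟹ E-85 is kernel-sound). [folklore] -/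
def FourPRankFromTwoPFiveModEight : Prop :=
  ∀ (p : ℕ) [NeZero (2 * p)] [NeZero (4 * p)], p.Prime → p % 8 = 5 →
    ∀ r : ℕ, TwoEisensteinRankEq (2 * p) r → TwoEisensteinRankEq (4 * p) (2 * r + 1)

/-- Mazur's theorem at level `p` in this vocabulary (printed: Mazur 1977, Prop. II.9.7 / Thm. II.18.10 — there is a weight-2 cusp form on
`Γ₀(p)` congruent to the Eisenstein series mod a prime `q` iff `q ∣ num((p−1)/12)`; for `q = 2`: iff `p ≡ 1 (mod 8)`).  Stated as a
`Prop` to be used as a NAMED HYPOTHESIS (not a tree fact yet). 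
REF1 §R65 H-3: TRUE ON PAPER but NOT literally Mazur's printed statement (his Eisenstein ideal contains `T₂ − 3`; the
ODD-anemic version typed here = LEMMA-g16-2 (⟸) + Mazur 1977 Thm. 1); filed as an open tree obligation (statement-only fact of
the cell, to be cited so).  VERBATIM Sketch-imc-g16 (T-imc-10).
[cite: Mazur1977, Thm. 1 and Prop. II.9.7 (q ∣ num((p−1)/12); q = 2 iff p ≡ 1 (mod 8) — odd-anemic reformulation by PROOFS-g16 LEMMA-g16-2)] -/
@[conjecture]
def MazurNoTwoEisensteinPrimeLevel : Prop :=
  ∀ (p : ℕ) [NeZero p], p.Prime → 5 ≤ p → p % 8 ≠ 1 → TwoEisensteinRankEq p 0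

/-- **EDGE (kernel-checked bookkeeping):** the general rank law + Mazur give the `p ≡ 5 (mod 8)` instance, granted that the three
rank at `4p` EXISTS as a number (`hex`: every level has some 2-Eisenstein rank — true since `S₂(ℤ)` is finite free, recorded as a hypothesis). [folklore] -/
theorem fourPRankFromTwoP_of_rankLaw (hlaw : FourPTwoPRankLaw) (hMazur : MazurNoTwoEisensteinPrimeLevel)
    (hex : ∀ (N : ℕ) [NeZero N], ∃ r, TwoEisensteinRankEq N r) :
    FourPRankFromTwoPFiveModEight := by
  intro p _ _ hp h5 r hr
  haveI : NeZero p := ⟨hp.ne_zero⟩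
  have hp5 : 5 ≤ p := by omega
  have h81 : p % 8 ≠ 1 := by omega
  have h41 : p % 4 = 1 := by omega
  obtain ⟨r₄, hr₄⟩ := hex (4 * p)
  have key := hlaw p hp hp5 0 r r₄ (hMazur p hp hp5 h81) hr hr₄
  simp only [h41, if_true] at key
  have : r₄ = 2 * r + 1 := by omega
  rw [← this]; exact hr₄

/-! ### §4. Sanity (`decide`): the parity bookkeeping of the three supersingular sets -/

/-- `#Σ₄(p) = (p−1)/2` is even iff `p ≡ 1 (mod 4)`; `#SS(X₀(2)) = (p−1)/4` resp. `(p+1)/4` is even iff `p ≡ 1 (8)` resp. `p ≡ 7 (8)` —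
the existence pattern of the census, checked on residues mod 16. -/
example : ∀ q : Fin 16, (q.val % 2 = 1) →
    (((q.val + 16 - 1) / 2) % 2 = 0 ↔ q.val % 4 = 1) := by decide

example : ∀ q : Fin 16, q.val % 8 = 1 → ((q.val + 16 - 1) / 4) % 2 = 0 := by decide
example : ∀ q : Fin 16, q.val % 8 = 5 → ((q.val + 16 - 1) / 4) % 2 = 1 := by decide
example : ∀ q : Fin 16, q.val % 8 = 7 → ((q.val + 16 + 1) / 4) % 2 = 0 := by decide
example : ∀ q : Fin 16, q.val % 8 = 3 → ((q.val + 16 + 1) / 4) % 2 = 1 := by decide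

/-- the family `p = m² + 4`, `m` odd, lies in the class `p ≡ 5 (mod 8)` where `v₂((p−1)/2) = 1`. -/
example : ∀ m : Fin 16, m.val % 2 = 1 → (m.val ^ 2 + 4) % 8 = 5 ∧ ((m.val ^ 2 + 4 - 1) / 2) % 4 = 2 := by decide

end Summit.BirchSwinnertonDyer.Rank1Residual.ManinAdditive.TwoEisenstein

end
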